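import Summits.ABC.IUTFork.LDHGenuinePoint
import Summits.ABC.IUTFork.LDHGenuinePerImageSufficiency
import HarnessLib

/-!
# The fork at [IUTchIII] Corollary 3.12, L-DH level, READING (P): with ZERO indeterminacy gain the per-image Corollary
# reads `κ_l·log q^{∤2l}(λ) ≤ ((l+5)/4)·log π` — false at every datum with `log q^{∤2l}(λ) ≥ 24`
# (abc-iut cell, crux ThetaPartII = stmt-ABC-19678; row «C:PERIMAGE-IND2-SEMILINEAR», part 2: the genuine-input currency)

Record-only PROOF file (D-0012) of the abc-iut cell (WAVE-3 discharge seat abc-iut-c312-d1, gen 10; C LEAD ruling C-R93 (a); the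
numerical half of referee finding **F-B28-1**, ref-b pass B28 `ref/REFEREE-PASS-B28.md` §2). TAKES NO SIDE on [IUTchIII] Cor. 3.12.

CONTEXT. The cell's typed per-image reading (P) of [IUTchIII] Cor. 3.12 at a genuine input `I` compares `−|log(q)|` with
`−|log(Θ)|_(P) = Σ_p ln ν̄(hull of the (Ind2)-orbit of the Θ-region) + ((l+5)/4)·log π`, the orbit being taken under the tree's
(Ind2) = the Dupuy–Hilado CONTAINER `Aut_{ℚ_p}(V : log_p(R_I^×))` (`TensorPacketShell.indTwo`). Over the container the orbit hull of the
Θ-region `ι_j(t)·(R_I)^∼` is `hull(p^m·log_p(R_I^×))` (abc-iut-w5-d180 / s2-p2, `packetHull_orbit_eq_zpow`,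
`GenuineLogThetaPerImageExactVolume`) and the resulting different-plus-shell GAIN is what makes typed-(P) hold at every tabulated
Szpiro-bad datum (this lineage's «C:PERIMAGE-DIFFSHARP» / «C:PERIMAGE-SHELL» rows). The companion Literature file `TensorPacketOrbitStable` (this
seat, same row) proves the other end at the packet level: over ANY family of container elements that STABILISES the Θ-region — unit
multiplications of `(R_I)^∼`, `(R_I)^∼`-preserving algebra automorphisms fixing `ι_j(t)`, in particular the unit scalars
`ℤ_p^× = Im(Ẑ^×)` of [IUTchII] Ex. 1.8 (iv) — the orbit hull IS the region and its `log μ̄` is the BARE value: ZERO gain.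

THIS FILE spells out what zero gain means for the typed Corollary, in the cell's EXISTING vocabulary (the gain-`δ` hull estimate
`HullEstimatePerImageOf δ : −|log(Θ)|^{nonarch}_(P) ≤ −deĝ̲_lgp(P_Θ) + δ`; `δ = 0` is «zero gain»; by `LDHGenuinePerImageShallow` the
per-image volume is never BELOW the bare value, so `δ = 0` is the least possible):

* `ThetaVolumeInput.not_cor312PerImageOf_of_hullEstimatePerImageOf_of_lt` — gain `≤ δ` and `δ + ((l+5)/4)·log π < deĝ̲_lgp(P_Θ) −
  deĝ̲(P_q)` ⟹ `¬ Cor312PerImageOf I`; `…_zero` — the case `δ = 0`;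
* `ThetaVolumeInput.closedForm_le_zero_of_hullEstimatePerImageOf_zero` — zero gain forces the closed-form DIFFERENT gain
  `Σ_p (((ℓ⋆+3)/2)·Σ_u Pr(u)·d(K_u̲) − Σ_u d(K_u̲))·log p ≤ 0` (gen 7's `closedForm_le_of_hullEstimatePerImageOf` at `δ = 0`): at a
  genuine WILD datum the typed container reading is never at zero gain;
* at the Θ-data of a point `(P, l)`, `λ ∈ U_X` (gap `= κ_l·log q^{∤2l}(λ)`, `κ_l = (l+1)/24 − 1/(2l)`, `PointDict.gap_eq`):
  `Cor22.ThetaVolumeDatumAt.not_cor312PerImageOf_of_hullEstimatePerImageOf_zero_of_lt` — zero gain and `((l+5)/4)·log π <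
  κ_l·log q^{∤2l}(λ)` ⟹ `¬ T.Cor312PerImageOf`; `…_zero_szpiro` — `l ≥ 5` and `(6l(l+5)/((l+4)(l−3)))·log π < log q^{∤2l}(λ)`;
  **`…_zero_of_le`** — `l ≥ 5` and `24 ≤ log q^{∤2l}(λ)` (`6l(l+5)/((l+4)(l−3)) ≤ 50/3` for `l ≥ 5`, `log π < log 4 < 1.39`).

READING (numbers about OUR typed objects; C-R93 (a) honest words): over any Θ-region-STABILISING sub-indeterminacy of the container
the per-image reading would be at zero gain (companion file), and at zero gain the typed per-image Corollary FAILS at every genuine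
datum of every point with `log q^{∤2l}(λ) ≥ 24` (every tabulated Szpiro-bad datum of the cell has `log q^{∤2l} > 40`) — whereas over
the full container it HOLDS at all of them. Which sub-indeterminacies print's (Ind2) intends (factorwise `Ism`, [IUTchII] Ex. 1.8 (iv);
[IUTchIII] Thm. 3.11 (i)) and whether they stabilise the Θ-regions is READING MATTER for the referees (F-B28-1: «typed-(P) does not
decide print-(P)»); nothing here decides it, asserts the existence of data, or takes a side; no abc claim.
[cite: Mochizuki2012, IUTchIII Cor. 3.12 p. 173–174, proof Step (x) p. 181; IUTchIV Thm. 1.10 Steps (v)–(viii) p. 27–31; IUTchII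
Ex. 1.8 (iv) p. 39] [cite: DupuyHilado2025, §4.9, §4.12] [claim: Mochizuki2012, status: disputed] for every IUT quotation.
PROOF-ONLY: no definitions, no new `Prop`.
-/

noncomputable section

open NumberField IsDedekindDomain

namespace Literature.IUT.LogVolume

open Literature.NumberTheory.DiophantineGeometry.GenEll Summit.ABC.IUTFork

/-! ## 1. Input level: gain `≤ δ` with `δ` below the gap refutes the per-image Corollary -/

namespace ThetaVolumeInput

variable {F₀ : Type} [Field F₀] [NumberField F₀] {K : Type} [Field K] [NumberField K] [Algebra F₀ K]
variable (I : ThetaVolumeInput F₀ K)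

/-- **Gain `≤ δ` below the gap ⟹ `¬ (P)`**: if `−|log(Θ)|^{nonarch}_(P) ≤ −deĝ̲_lgp(P_Θ) + δ` and
`δ + ((l+5)/4)·log π < deĝ̲_lgp(P_Θ) − deĝ̲(P_q)`, then the typed per-image Corollary fails for `I` (contrapositive of the squeeze
`gap_le_of_cor312PerImageOf_of_hullEstimatePerImageOf`). [cite: Mochizuki2012, IUTchIV Thm. 1.10 Steps (viii)–(x) p. 30–32]
[claim: Mochizuki2012, status: disputed] -/
theorem not_cor312PerImageOf_of_hullEstimatePerImageOf_of_lt {δ : ℝ} (h : I.HullEstimatePerImageOf δ)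
    (hgap : δ + archLogTheta I.l < LgpDivisor.ndegLgp I.X.thetaPilot - FinDivisor.ndeg F₀ I.X.qPilot) :
    ¬ I.Cor312PerImageOf := fun h1 =>
  absurd (I.gap_le_of_cor312PerImageOf_of_hullEstimatePerImageOf h1 h) (not_le.mpr hgap)

/-- **ZERO GAIN below the gap ⟹ `¬ (P)`**: if the per-image volume is the BARE one (`HullEstimatePerImageOf 0`) and
`((l+5)/4)·log π < deĝ̲_lgp(P_Θ) − deĝ̲(P_q)`, the typed per-image Corollary fails for `I`.
[cite: Mochizuki2012, IUTchIV Thm. 1.10 Steps (viii)–(x) p. 30–32] [claim: Mochizuki2012, status: disputed] -/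
theorem not_cor312PerImageOf_of_hullEstimatePerImageOf_zero (h : I.HullEstimatePerImageOf 0)
    (hgap : archLogTheta I.l < LgpDivisor.ndegLgp I.X.thetaPilot - FinDivisor.ndeg F₀ I.X.qPilot) :
    ¬ I.Cor312PerImageOf :=
  I.not_cor312PerImageOf_of_hullEstimatePerImageOf_of_lt h (by rw [zero_add]; exact hgap)

/-- **Zero gain kills the different gain**: `HullEstimatePerImageOf 0` forces the closed-form different gain of this lineage's
sufficiency (`GenuineContent.closedForm_le_of_hullEstimatePerImageOf`, gen 7) to be `≤ 0`:
`Σ_{p∈T(I)} (((ℓ⋆+3)/2)·Σ_{u|p} Pr(u)·d(K_u̲) − Σ_{u|p} d(K_u̲))·log p ≤ 0`. At the typed CONTAINER reading the left side is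
the landed LOWER end of the gain, so a genuine input with positive different gain is never at zero gain.
[cite: Mochizuki2012, IUTchIV Prop. 1.1 p. 9; Thm. 1.10 Step (v) p. 27–29] [claim: Mochizuki2012, status: disputed] -/
theorem closedForm_le_zero_of_hullEstimatePerImageOf_zero (h : I.HullEstimatePerImageOf 0) :
    ∑ p ∈ I.supportPrimes,
        (if hp : p.Prime then
          haveI : Fact p.Prime := ⟨hp⟩
          ((((I.X.lstar : ℝ) + 3) / 2) *
              ∑ u : placesOver F₀ p, weight F₀ u.1 * differentOrd p ((I.σ.localFieldFamily p hp).k u)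
            - dSum p (fun u : placesOver F₀ p => (I.σ.localFieldFamily p hp).k u)) * Real.log p
         else 0) ≤ 0 :=
  GenuineContent.closedForm_le_of_hullEstimatePerImageOf I h

end ThetaVolumeInput

/-! ## 2. At the Θ-data of a point `(P, l)`: zero gain reads `κ_l·log q^{∤2l}(λ) ≤ ((l+5)/4)·log π` -/

namespace Cor22

namespace ThetaVolumeDatumAt

variable {P : NFPoint} {l : ℕ} (T : ThetaVolumeDatumAt P l)

/-- **At a datum: gain `≤ δ` below the gap ⟹ `¬ (P)`**: `λ ∈ U_X`, `T.HullEstimatePerImageOf δ` and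
`δ + ((l+5)/4)·log π < ((l+1)/24 − 1/(2l))·log q^{∤2l}(λ)` ⟹ `¬ T.Cor312PerImageOf` (`PointDict.gap_eq`).
[cite: Mochizuki2012, IUTchIV Thm. 1.10 Steps (viii)–(x) p. 30–32] [claim: Mochizuki2012, status: disputed] -/
theorem not_cor312PerImageOf_of_hullEstimatePerImageOf_of_lt (hU : P.InU) {δ : ℝ} (h : T.HullEstimatePerImageOf δ)
    (hQ : δ + ((l : ℝ) + 5) / 4 * Real.log Real.pi < (((l : ℝ) + 1) / 24 - 1 / (2 * l)) * logQAvoid P {2, l}) :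
    ¬ T.Cor312PerImageOf := by
  intro h1
  have hsq := T.gap_le_perImage h1 h
  rw [PointDict.gap_eq T hU] at hsq
  have harch : ThetaVolumeInput.archLogTheta l = ((l : ℝ) + 5) / 4 * Real.log Real.pi := rfl
  rw [harch] at hsq
  linarith

/-- **At a datum: ZERO gain ⟹ `¬ (P)` as soon as `((l+5)/4)·log π < κ_l·log q^{∤2l}(λ)`.**
[cite: Mochizuki2012, IUTchIV Thm. 1.10 Steps (viii)–(x) p. 30–32] [claim: Mochizuki2012, status: disputed] -/
theorem not_cor312PerImageOf_of_hullEstimatePerImageOf_zero_of_lt (hU : P.InU) (h : T.HullEstimatePerImageOf 0)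
    (hQ : ((l : ℝ) + 5) / 4 * Real.log Real.pi < (((l : ℝ) + 1) / 24 - 1 / (2 * l)) * logQAvoid P {2, l}) :
    ¬ T.Cor312PerImageOf :=
  T.not_cor312PerImageOf_of_hullEstimatePerImageOf_of_lt hU h (by rw [zero_add]; exact hQ)

/-- **Szpiro form** (`l ≥ 5`, `κ_l = (l+4)(l−3)/(24l) > 0`): zero gain and `(6l(l+5)/((l+4)(l−3)))·log π < log q^{∤2l}(λ)` ⟹
`¬ T.Cor312PerImageOf`. [cite: Mochizuki2012, IUTchIV Thm. 1.10 Steps (viii)–(x) p. 30–32] [claim: Mochizuki2012, status: disputed] -/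
theorem not_cor312PerImageOf_of_hullEstimatePerImageOf_zero_szpiro (hU : P.InU) (h5 : 5 ≤ l)
    (h : T.HullEstimatePerImageOf 0)
    (hQ : 6 * l * ((l : ℝ) + 5) / (((l : ℝ) + 4) * ((l : ℝ) - 3)) * Real.log Real.pi < logQAvoid P {2, l}) :
    ¬ T.Cor312PerImageOf := by
  refine T.not_cor312PerImageOf_of_hullEstimatePerImageOf_zero_of_lt hU h ?_
  have hl5 : (5 : ℝ) ≤ l := by exact_mod_cast h5
  have hl0 : (0 : ℝ) < l := by linarith
  have hden : 0 < ((l : ℝ) + 4) * ((l : ℝ) - 3) := by nlinarith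
  have hκ : ((l : ℝ) + 1) / 24 - 1 / (2 * l) = ((l : ℝ) + 4) * ((l : ℝ) - 3) / (24 * l) := by
    field_simp
    ring
  have hκpos : 0 < ((l : ℝ) + 4) * ((l : ℝ) - 3) / (24 * l) := by positivity
  have hmul := mul_lt_mul_of_pos_left hQ hκpos
  have h3 : (l : ℝ) - 3 ≠ 0 := by linarith
  have h4 : (l : ℝ) + 4 ≠ 0 := by linarith
  have hleft : ((l : ℝ) + 4) * ((l : ℝ) - 3) / (24 * l) *
      (6 * l * ((l : ℝ) + 5) / (((l : ℝ) + 4) * ((l : ℝ) - 3)) * Real.log Real.pi) =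
      ((l : ℝ) + 5) / 4 * Real.log Real.pi := by
    field_simp
    ring
  rw [hκ, ← hleft]
  exact hmul

/-- **Uniform form**: `l ≥ 5`, zero gain and `24 ≤ log q^{∤2l}(λ)` ⟹ `¬ T.Cor312PerImageOf` (`6l(l+5)/((l+4)(l−3)) ≤ 50/3` on
`l ≥ 5`, and `(50/3)·log π ≤ (100/3)·log 2 < 24`). Every tabulated Szpiro-bad datum of the cell has `log q^{∤2l} > 40`.
[cite: Mochizuki2012, IUTchIV Thm. 1.10 Steps (viii)–(x) p. 30–32] [claim: Mochizuki2012, status: disputed] -/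
theorem not_cor312PerImageOf_of_hullEstimatePerImageOf_zero_of_le (hU : P.InU) (h5 : 5 ≤ l)
    (h : T.HullEstimatePerImageOf 0) (hQ : 24 ≤ logQAvoid P {2, l}) : ¬ T.Cor312PerImageOf := by
  refine T.not_cor312PerImageOf_of_hullEstimatePerImageOf_zero_szpiro hU h5 h (lt_of_lt_of_le ?_ hQ)
  have hl5 : (5 : ℝ) ≤ l := by exact_mod_cast h5
  have hden : 0 < ((l : ℝ) + 4) * ((l : ℝ) - 3) := by nlinarith
  -- `6l(l+5)/((l+4)(l−3)) ≤ 50/3`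
  have hcoef : 6 * l * ((l : ℝ) + 5) / (((l : ℝ) + 4) * ((l : ℝ) - 3)) ≤ 50 / 3 := by
    rw [div_le_div_iff₀ hden (by norm_num)]
    nlinarith
  -- `log π ≤ log 4 = 2·log 2 < 1.3863`
  have hpi : Real.log Real.pi ≤ 2 * Real.log 2 := by
    have h4 : Real.log Real.pi ≤ Real.log 4 := Real.log_le_log Real.pi_pos Real.pi_le_four
    have h22 : Real.log 4 = 2 * Real.log 2 := by
      rw [show (4 : ℝ) = 2 ^ 2 by norm_num, Real.log_pow]; norm_num
    linarith
  have hlog2 := Real.log_two_lt_d9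
  have hpipos : 0 < Real.log Real.pi := Real.log_pos (by linarith [Real.pi_gt_three])
  calc 6 * l * ((l : ℝ) + 5) / (((l : ℝ) + 4) * ((l : ℝ) - 3)) * Real.log Real.pi
      ≤ 50 / 3 * Real.log Real.pi := mul_le_mul_of_nonneg_right hcoef hpipos.le
    _ ≤ 50 / 3 * (2 * Real.log 2) := by nlinarith
    _ < 24 := by nlinarith

end ThetaVolumeDatumAt

end Cor22

end Literature.IUT.LogVolume

end
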